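import Summits.BirchSwinnertonDyer.BirchSwinnertonDyer.Theses.TameQuarticManinParity
import Summits.BirchSwinnertonDyer.BirchSwinnertonDyer.Theorems.TameQuarticManinParityIrrManinUnitOfIIIstarHalf
import HarnessLib

/-!
# Route `TameQuarticManinParity`, LINE 39 (bsd-idea-3 g11), glue H39 `TprimeIrrManinUnitOfTameStarred`
# (stmt-BirchSwinnertonDyer-24047) — PROVED BY NAME (the planner's `Sketch39.lean`, re-checked by refuter ref-g8 b16)

Cell `pub/bsd-wall`, D-0145 line `route-BirchSwinnertonDyer-TeichmullerTwistDescent`, seat `bsd-line-ttd-p1` g15,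
working the planner-of-record's TQMP LINE 39. BSD is NOT proved by this; Manin's conjecture is not proved by this;
E57′ (`TprimeTameStarredOptimalManinUnit`, stmt-24046), P (`TprimeIrrTwistPartnerOptimalDatum`), O22
(`TprimeIrrTwistLatticeOrientation`), ML (`TprimeIrrManinLeOfOrientation`) and MD
(`TprimeIrrManinUnitOfDegreePrimeToThree`) stay OPEN route items, hence so does the organ
`TprimeIrrManinUnitOfThreeDvdDegree` (24498). This file closes ONLY the glue.

## Statement (verbatim the route decl)

`TprimeTameStarredOptimalManinUnit → TprimeIrrTwistPartnerOptimalDatum → TprimeIrrTwistLatticeOrientation →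
TprimeIrrManinLeOfOrientation → TprimeIrrManinUnitOfDegreePrimeToThree → TprimeIrrManinUnitOfThreeDvdDegree`.

## Proof

The landed G22 `tprimeIrrManinUnitOfIIIstarHalf_proof` takes P, O22, ML, MD and the III*-half hypothesis hIIIstar;
E57′ is hIIIstar with the three idle hypotheses (¬CM, ρ̄₃ irreducible, 3 ∣ deg φ) dropped, so it supplies hIIIstar
by weakening. Pure logic. Design: theorems only; no definition, no named fact, no `sorry`; axioms `propext`,
`Classical.choice`, `Quot.sound`.
-/

set_option autoImplicit false
-- D-0017: single-problem summit, so `Summit.BirchSwinnertonDyer.BirchSwinnertonDyer.…` repeats a namespace BY DESIGN.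
set_option linter.dupNamespace false

namespace Summit.BirchSwinnertonDyer.BirchSwinnertonDyer.Theorems.TameQuarticManinParity

open Summit.BirchSwinnertonDyer.BirchSwinnertonDyer.Theses.TameQuarticManinParity

/-- **Glue H39** (stmt-BirchSwinnertonDyer-24047), by name: E57′ (the III*-cell optimal Manin unit at 3, no
irreducibility / non-CM / degree hypothesis) together with P, O22, ML and the ČNS half MD gives the irreducible organ
`TprimeIrrManinUnitOfThreeDvdDegree`, through the landed G22 `tprimeIrrManinUnitOfIIIstarHalf_proof` (E57′ is its
hIIIstar weakened by the unused hypotheses). -/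
theorem tprimeIrrManinUnitOfTameStarred_proof : TprimeIrrManinUnitOfTameStarred := by
  unfold TprimeIrrManinUnitOfTameStarred
  intro h57 hP hO hML hMD
  refine tprimeIrrManinUnitOfIIIstarHalf_proof hP hO hML hMD ?_
  intro W _ _ _ _hCM hA hT _hirr h9 D hL hopt _h3
  exact h57 W hA hT h9 D hL hopt

end Summit.BirchSwinnertonDyer.BirchSwinnertonDyer.Theorems.TameQuarticManinParity
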